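import Summits.ValiantsHypothesis.ValiantsHypothesis.Theorems.ToricFixedPoints.Negative.FormDeborderingPositiveCases3m

/-!
# `ToricFixedPoints` / line `form_then_lift`, stub F1: `End·det_m = {forms of degree m with dc ≤ m}`

Equal-size companion of `FormDeborderingPaddedEndIffDc` (which needs `m ≥ 4` so that `ℓ` is not a block
variable): for a form `q` of degree `m` in the `m²` matrix variables,
`q ∈ End(ℂ^{m²})·det_m ↔ dc(q) ≤ m` (`mem_endOrbit_detPoly_iff_dc_le`).  At `m = 3` this is the
dictionary used for F1 at `(3,3)` (`FormDeborderingContentClasses33`, `…PermFamily33`, `…EndType`): the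
End-type = toric-outright cubics are exactly the cubics of affine determinantal complexity `≤ 3`, and F1's
content at `(3,3)` is confined to border cubics `q ∈ Det₃` with `dc(q) ≥ 4`.
Refuter/theory seat `val-width-5779-d1` (stmt-ValiantsHypothesis-5779).  VP ≠ VNP is not touched.
-/

open MvPolynomial Finset
open Literature.Computability.AlgebraicComplexity

namespace Summit.ValiantsHypothesis.Cruxes.ToricFixedPoints.Negative

/-- **`End·det_m` = degree-`m` forms with `dc ≤ m`.** [folklore] -/
theorem mem_endOrbit_detPoly_iff_dc_le (m : ℕ) [NeZero m] {q : MvPolynomial (Fin m × Fin m) ℂ}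
    (hq : q.IsHomogeneous m) :
    q ∈ endOrbit (Fin m × Fin m) ℂ (detPoly (Fin m) ℂ) ↔ determinantalComplexity q ≤ m := by
  refine ⟨dc_le_of_mem_endOrbit_detPoly m, fun h => ?_⟩
  have hA : HasDetRepr q m := (hasDetRepr_iff_determinantalComplexity_le_holds q m).2 h
  have hmem := X_pow_mul_aeval_mem_endOrbit_detPoly hq le_rfl hA
    (isHomogeneous_X ℂ ((0 : Fin m), (0 : Fin m))) (X_ne_zero _) X fun t => isHomogeneous_X ℂ t
  rwa [Nat.sub_self, pow_zero, one_mul, aeval_X_left, AlgHom.id_apply] at hmem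

end Summit.ValiantsHypothesis.Cruxes.ToricFixedPoints.Negative
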